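import Mathlib
import Summits.ValiantsHypothesis.ValiantsHypothesis.Theorems.FifoMatchingNNDivisionHardFewGeneratorsExp
import Summits.ValiantsHypothesis.ValiantsHypothesis.Theorems.FifoMatchingNNNotVPDivisionSplitDefs
import HarnessLib

/-!
# Crux `Theses.FifoMatching.NNNotVP` (stmt-ValiantsHypothesis-11615), line `division_split`, stub B2
# `stub_spreadCofactorReduction` ≡ EXPONENTIAL DIVISION HARDNESS OF `NN` (✓ `…NNNotVPSpreadCofactorIffExpHard`, p836105):
# the exponential law HOLDS on the cofactors with at most `2^{κ√n}` monomials (any degree)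

By ✓ `spreadCofactorReduction_iff_expDivisionHard` the registered open stub B2 of line `division_split` is, verbatim,
`∃ r n₀, ∀ n ≥ n₀, ∀ h ≠ 0, n ≤ (log₂ (L₊(NN_n · h) + L₊(h)))^r`.  This file records the instance of that law decided by
leafhand-8-g1's few-generator tier (✓ `…NNDivisionHardFewGeneratorsExp.nn_complexity_expLowerBound_fewMonomials`:
`2^{κ√n} ≤ L₊(NN_n · h)` whenever `|supp h| ≤ 2^{κ√n}`), with exponent `r = 3`:

* ★ `expDivisionHard_fewMonomials` — `∃ κ > 0, ∃ n₀, ∀ n ≥ n₀, ∀ h ≠ 0` with `|supp h| ≤ 2^{κ√n}`: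
  `n ≤ (log₂ (L₊(NN_n · h) + L₊(h)))^3` (in the `NN n` / `σ n` spelling of `…NNNotVPDivisionSplitDefs`, i.e. B2's right-hand side
  restricted to the class).

HONEST FRAMING: B2 (all cofactors) stays OPEN (≡ exponential `NNDivisionHard`, HY21 §6 Problem 2 at exponential rate); Z =
`ZeroOneTransfer` OPEN; `NNNotVP` OPEN; `VP ≠ VNP` NOT proved.  No definitions, no named facts, no sorry.
-/

set_option autoImplicit false

-- the mandated summit-side namespace repeats a component by design (single-problem summit)
set_option linter.dupNamespace false

noncomputable section

namespace Summit.ValiantsHypothesis.ValiantsHypothesis.Theorems.FifoMatching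

namespace FewGenerators

open MvPolynomial
open scoped NNReal
open Literature.Computability.AlgebraicComplexity (complexity nestFreeMatchingPoly)
open Summit.ValiantsHypothesis.ValiantsHypothesis.Theorems.FifoMatching.NNNotVP.DivisionSplit (σ NN)

/-- ★ **B2's exponential law on the few-monomial class**: there is `κ > 0` such that, eventually in `n`, every cofactor `h ≠ 0`
over `ℝ≥0` with `|supp h| ≤ 2^{κ√n}` has `n ≤ (log₂ (L₊(NN_n · h) + L₊(h)))^3`. [cite: HrubesYehudayoff2021, §6 Problem 2] -/
theorem expDivisionHard_fewMonomials : ∃ κ : ℝ, 0 < κ ∧ ∃ n₀ : ℕ, ∀ n ≥ n₀,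
    ∀ h : MvPolynomial (σ n) ℝ≥0, h ≠ 0 → (h.support.card : ℝ) ≤ (2 : ℝ) ^ (κ * Real.sqrt n) →
      n ≤ (Nat.log 2 (complexity (NN n * h) + complexity h)) ^ 3 := by
  obtain ⟨κ, hκ, n₁, H⟩ := nn_complexity_expLowerBound_fewMonomials
  obtain ⟨N, hN⟩ := exists_nat_ge ((8 / κ ^ 3) ^ 2 + (2 / κ) ^ 2)
  refine ⟨κ, hκ, max n₁ N, fun n hn h hh hcard => ?_⟩
  have hn₁ : n₁ ≤ n := le_trans (le_max_left _ _) hn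
  have hnN : ((8 / κ ^ 3) ^ 2 + (2 / κ) ^ 2 : ℝ) ≤ n :=
    hN.trans (by exact_mod_cast le_trans (le_max_right _ _) hn)
  have hL := H n hn₁ h hh hcard
  set M : ℕ := complexity (NN n * h) + complexity h with hM
  set t : ℕ := Nat.log 2 M with ht
  -- `2^{κ√n} ≤ L₊(NN_n·h) ≤ M < 2^{t+1}`, so `κ√n < t + 1`
  have hLM : (complexity (nestFreeMatchingPoly n ℝ≥0 * h) : ℝ) ≤ M := by
    rw [hM]; push_cast
    show (complexity (nestFreeMatchingPoly n ℝ≥0 * h) : ℝ) ≤ (complexity (NN n * h) : ℝ) + (complexity h : ℝ)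
    have : (0 : ℝ) ≤ (complexity h : ℝ) := Nat.cast_nonneg _
    have hNN : NN n = nestFreeMatchingPoly n ℝ≥0 := rfl
    rw [hNN]; linarith
  have hMt : (M : ℝ) < (2 : ℝ) ^ ((t : ℝ) + 1) := by
    have h1 : M < 2 ^ (t + 1) := Nat.lt_pow_succ_log_self (by norm_num) M
    have h2 : (M : ℝ) < (2 : ℝ) ^ (t + 1) := by exact_mod_cast h1
    have h3 : (2 : ℝ) ^ ((t : ℝ) + 1) = (2 : ℝ) ^ (t + 1) := by
      rw [show ((t : ℝ) + 1) = ((t + 1 : ℕ) : ℝ) by push_cast; ring, Real.rpow_natCast]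
    rw [h3]; exact h2
  have hlt : κ * Real.sqrt n < (t : ℝ) + 1 := by
    have := lt_of_le_of_lt (hL.trans hLM) hMt
    exact (Real.rpow_lt_rpow_left_iff (by norm_num : (1 : ℝ) < 2)).1 this
  -- `√n ≥ 8/κ³` and `√n ≥ 2/κ`
  have hsq1 : 8 / κ ^ 3 ≤ Real.sqrt n := by
    rw [show (8 / κ ^ 3 : ℝ) = Real.sqrt ((8 / κ ^ 3) ^ 2) by rw [Real.sqrt_sq (by positivity)]]
    exact Real.sqrt_le_sqrt (by nlinarith [sq_nonneg (2 / κ)])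
  have hsq2 : 2 / κ ≤ Real.sqrt n := by
    rw [show (2 / κ : ℝ) = Real.sqrt ((2 / κ) ^ 2) by rw [Real.sqrt_sq (by positivity)]]
    exact Real.sqrt_le_sqrt (by nlinarith [sq_nonneg (8 / κ ^ 3)])
  have hx2 : 2 ≤ κ * Real.sqrt n := by
    have := mul_le_mul_of_nonneg_left hsq2 hκ.le
    rwa [show κ * (2 / κ) = 2 by field_simp] at this
  have hx8 : 8 / κ ^ 2 ≤ κ * Real.sqrt n := by
    have := mul_le_mul_of_nonneg_left hsq1 hκ.le
    rwa [show κ * (8 / κ ^ 3) = 8 / κ ^ 2 by field_simp] at this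
  -- `t ≥ κ√n/2`, hence `t³ ≥ κ³ n^{3/2}/8 ≥ n`
  have htx : κ * Real.sqrt n / 2 ≤ (t : ℝ) := by linarith
  have ht0 : (0 : ℝ) ≤ (t : ℝ) := Nat.cast_nonneg _
  have hsqn : Real.sqrt n * Real.sqrt n = n := Real.mul_self_sqrt (Nat.cast_nonneg n)
  have hkey : (n : ℝ) ≤ (t : ℝ) ^ 3 := by
    -- `(κ√n/2)³ = (κ³ √n / 8) · n ≥ n` since `κ³ √n ≥ 8` (from `κ·(κ√n) ≥ 8/κ`, i.e. `hx8`)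
    have hcube : (κ * Real.sqrt n / 2) ^ 3 ≤ (t : ℝ) ^ 3 :=
      pow_le_pow_left₀ (by positivity) htx 3
    have hk3 : (8 : ℝ) ≤ κ ^ 3 * Real.sqrt n := by
      have := mul_le_mul_of_nonneg_left hx8 (show (0 : ℝ) ≤ κ ^ 2 by positivity)
      rw [show κ ^ 2 * (8 / κ ^ 2) = 8 by field_simp] at this
      nlinarith
    have hs3 : Real.sqrt n ^ 3 = Real.sqrt n * n := by rw [pow_three, hsqn]
    have hexpand : (κ * Real.sqrt n / 2) ^ 3 = (κ ^ 3 * Real.sqrt n / 8) * n := by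
      rw [show (κ * Real.sqrt n / 2) ^ 3 = κ ^ 3 * Real.sqrt n ^ 3 / 8 by ring, hs3]; ring
    have hge : (n : ℝ) ≤ (κ * Real.sqrt n / 2) ^ 3 := by
      rw [hexpand]
      have hn0 : (0 : ℝ) ≤ n := Nat.cast_nonneg n
      nlinarith
    exact hge.trans hcube
  exact_mod_cast hkey

end FewGenerators

end Summit.ValiantsHypothesis.ValiantsHypothesis.Theorems.FifoMatching

end
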